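import Summits.ValiantsHypothesis.ValiantsHypothesis.Theorems.SymPencilPerFourInnerRankTenFamily

/-!
# Route `SymPencil` — inner rank of the `2 | 2` row split of `per_4`: the column type of the
# `y₂`-block is incompatible with (iY₃)
# (`--supports` stmt-ValiantsHypothesis-5674 `SdcSuperquadratic`; (8,8) column, isotropic-kernel
# route, step (B5)(iii-b) of memo `NOTE-p6g15-5674-IR12-reduction.md` §10)

**Theorem** (`false_of_column_iY₃`).  For a joint family `Σ_r c_r t_r((a,b),(y₂,y₃))² =
per (a; b; y₂; y₃)` (characteristic `0`, any number of squares) it is impossible that, for some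
coordinate `k`, all columns `j ≠ k` of all `y₂`-blocks `A₂(a)` vanish (`t_r((a,0),(e_j,0)) = 0`)
while (iY₃) holds (for every `y₃`, `a ↦ (t_r((a,0),(0,y₃)))_r` has rank `≤ 1`).

Proof.  For `y₂` with `(y₂)_k = 0`, `A₂(a)y₂ = 0`, and polarisation gives
`2 Σ_r c_r t_r((0,b),(y₂,0)) t_r((a,0),(0,y₃)) = per (a; b; y₂; y₃)`; by (iY₃) the left side is
"rank one in `a`": `per(a;b;y₂;y₃) per(a';b';y₂';y₃) = per(a';b;y₂;y₃) per(a;b';y₂';y₃)`, which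
fails at `(a,b,y₂,y₃) = (e_p,e_q,e_m,e_k)`, `(a',b',y₂') = (e_q,e_p,e_m)`.  Use: closes the
column-type sub-case of `FirstForm.firstForm_or_column` (memo §10).  Honest framing: a step in a
conditional reduction of the cells `(8,8,10)`, `(8,8,11)`; nothing about the window, the crux or
`VP ≠ VNP`.  No definitions, no named facts. [folklore]
-/

noncomputable section

-- single-conjunct layout: Sub = Summit, duplicated namespace component intended
set_option linter.dupNamespace false

namespace Summit.ValiantsHypothesis.ValiantsHypothesis.Theorems.SymPencilPerFourInnerRankColumnKill

open Matrix Finset Module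
open Summit.ValiantsHypothesis.ValiantsHypothesis.Theorems.SymPencilPerFourInnerRankRows
open Summit.ValiantsHypothesis.ValiantsHypothesis.Theorems.SymPencilPerFourInnerRankTenFamily

variable {K : Type*} [Field K] {ι : Type*} [Fintype ι]

/-- **Column type + (iY₃) is impossible.**  See the module docstring. [folklore] -/
theorem false_of_column_iY₃ [CharZero K] (c : ι → K)
    (t : ι → (((Fin 4 → K) × (Fin 4 → K)) →ₗ[K] ((Fin 4 → K) × (Fin 4 → K)) →ₗ[K] K))
    (hJ : ∀ a b y₂ y₃ : Fin 4 → K,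
      ∑ r, c r * (t r (a, b) (y₂, y₃)) ^ 2 = (Matrix.of ![a, b, y₂, y₃]).permanent)
    (k : Fin 4) (hcols : ∀ j : Fin 4, j ≠ k → ∀ (a : Fin 4 → K) r, t r (a, 0) (Pi.single j 1, 0) = 0)
    (hY₃ : ∀ (y x x' : Fin 4 → K) (r r' : ι),
      t r (x, 0) (0, y) * t r' (x', 0) (0, y) - t r (x', 0) (0, y) * t r' (x, 0) (0, y) = 0) :
    False := by
  -- `A₂(a) e_j = 0` for `j ≠ k`, so polarisation gives the product formula for `per (a; b; e_j; y₃)`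
  have key : ∀ (a b y₃ : Fin 4 → K) (j : Fin 4), j ≠ k →
      (Matrix.of ![a, b, Pi.single j 1, y₃]).permanent =
        2 * ∑ r, c r * t r (0, b) (Pi.single j 1, 0) * t r (a, 0) (0, y₃) := by
    intro a b y₃ j hj
    have h1 := polar c t hJ a b (Pi.single j 1) 0 0 y₃
    have h2 := polar c t hJ 0 b (Pi.single j 1) 0 0 y₃
    rw [per_zero_row₃, add_zero] at h1
    rw [per_zero_row₃, add_zero, per_zero_row₀] at h2
    have hu : ((a, b) : (Fin 4 → K) × (Fin 4 → K)) = (a, 0) + (0, b) := by simp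
    have hsplit₂ : ∀ r, t r (a, b) (Pi.single j 1, 0) = t r (0, b) (Pi.single j 1, 0) := fun r => by
      rw [hu, map_add, LinearMap.add_apply, hcols j hj a r, zero_add]
    have hsplit₃ : ∀ r, t r (a, b) (0, y₃) = t r (a, 0) (0, y₃) + t r (0, b) (0, y₃) := fun r => by
      rw [hu, map_add, LinearMap.add_apply]
    simp_rw [hsplit₂, hsplit₃] at h1
    rw [← h1]
    have : ∑ r, c r * t r (0, b) (Pi.single j 1, 0) * (t r (a, 0) (0, y₃) + t r (0, b) (0, y₃)) =
        ∑ r, c r * t r (0, b) (Pi.single j 1, 0) * t r (a, 0) (0, y₃) +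
          ∑ r, c r * t r (0, b) (Pi.single j 1, 0) * t r (0, b) (0, y₃) := by
      rw [← Finset.sum_add_distrib]; exact Finset.sum_congr rfl fun r _ => by ring
    rw [this]
    linear_combination h2
  -- rank one in `a`
  have rk : ∀ (a a' b b' y₃ : Fin 4 → K) (j j' : Fin 4), j ≠ k → j' ≠ k →
      (Matrix.of ![a, b, Pi.single j 1, y₃]).permanent *
          (Matrix.of ![a', b', Pi.single j' 1, y₃]).permanent =
        (Matrix.of ![a', b, Pi.single j 1, y₃]).permanent *
          (Matrix.of ![a, b', Pi.single j' 1, y₃]).permanent := by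
    intro a a' b b' y₃ j j' hj hj'
    rw [key a b y₃ j hj, key a' b' y₃ j' hj', key a' b y₃ j hj, key a b' y₃ j' hj']
    have expand : ∀ (f g f' g' : ι → K),
        (2 * ∑ r, f r * g r) * (2 * ∑ r, f' r * g' r) =
          4 * ∑ r, ∑ r', f r * f' r' * (g r * g' r') := by
      intro f g f' g'
      rw [mul_mul_mul_comm, Finset.sum_mul_sum, show (2 : K) * 2 = 4 by norm_num]
      congr 1
      exact Finset.sum_congr rfl fun r _ => Finset.sum_congr rfl fun r' _ => by ring
    rw [expand (fun r => c r * t r (0, b) (Pi.single j 1, 0)) (fun r => t r (a, 0) (0, y₃))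
        (fun r => c r * t r (0, b') (Pi.single j' 1, 0)) (fun r => t r (a', 0) (0, y₃)),
      expand (fun r => c r * t r (0, b) (Pi.single j 1, 0)) (fun r => t r (a', 0) (0, y₃))
        (fun r => c r * t r (0, b') (Pi.single j' 1, 0)) (fun r => t r (a, 0) (0, y₃))]
    congr 1
    refine Finset.sum_congr rfl fun r _ => Finset.sum_congr rfl fun r' _ => ?_
    have h := hY₃ y₃ a a' r r'
    rw [show t r (a, 0) (0, y₃) * t r' (a', 0) (0, y₃) = t r (a', 0) (0, y₃) * t r' (a, 0) (0, y₃)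
      by linear_combination h]
  -- the violation at `(e_p, e_q, e_m, e_k)`, `(a', b') = (e_q, e_p)`
  fin_cases k
  · -- k = 0: (p, q, m) = (1, 2, 3)
    have h := rk (Pi.single 1 1) (Pi.single 2 1) (Pi.single 2 1) (Pi.single 1 1)
      (Pi.single 0 1) 3 3 (by decide) (by decide)
    simp [permanent_of_rows] at h
  · -- k = 1: (p, q, m) = (0, 2, 3)
    have h := rk (Pi.single 0 1) (Pi.single 2 1) (Pi.single 2 1) (Pi.single 0 1)
      (Pi.single 1 1) 3 3 (by decide) (by decide)
    simp [permanent_of_rows] at h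
  · -- k = 2: (p, q, m) = (0, 1, 3)
    have h := rk (Pi.single 0 1) (Pi.single 1 1) (Pi.single 1 1) (Pi.single 0 1)
      (Pi.single 2 1) 3 3 (by decide) (by decide)
    simp [permanent_of_rows] at h
  · -- k = 3: (p, q, m) = (0, 1, 2)
    have h := rk (Pi.single 0 1) (Pi.single 1 1) (Pi.single 1 1) (Pi.single 0 1)
      (Pi.single 3 1) 2 2 (by decide) (by decide)
    simp [permanent_of_rows] at h

end Summit.ValiantsHypothesis.ValiantsHypothesis.Theorems.SymPencilPerFourInnerRankColumnKill

end
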